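import Summits.HubbardSuperconductivity.HubbardSuperconductivity.Theorems.BalabanIRBirEveryGroundStateHeadCount
import Summits.HubbardSuperconductivity.HubbardSuperconductivity.Theorems.BalabanIRBirEveryGroundState

/-!
# Route `BalabanIR`, crux 5 `BirEveryGroundState` (item `stmt-HubbardSuperconductivity-2083`):
# average + second moment + bounded degeneracy ⇒ EVERY ground state (the moment endgame)

The genericity-free cut of the average → every problem proposed in the crux file
`Cruxes/BirEveryGroundState/RESHAPE-ideator1.md` ("pass the second moment through the target"):
for a Hermitian `Y`, a subspace `K ≠ ⊥` with projection matrix `P` (`m = re tr P = dim K`),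
tracial mean `ȳ = re tr (P Y) / m` and COMPRESSION second moment `re tr (P Y P Y)`,

* `compressionVarianceHeadCount` : every unit `ψ ∈ K` has
  `ȳ - √(re tr (P Y P Y) - m ȳ²) ≤ re ⟨ψ, Y ψ⟩` (the sharper, compression form of
  `varianceHeadCount`, which has `re tr (P Y Y) ≥ re tr (P Y P Y)` under the root);
* `forall_unit_le_re_of_moments` : the three TRACE clauses
  `c₀ · re tr P ≤ re tr (P Y)` (average), `re tr (P Y P Y) · re tr P ≤ (1 + ε) (re tr (P Y))²`
  (second moment / time-clustering clause) and `re tr P ≤ D` (bounded degeneracy) with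
  `ε D ≤ 1/4` force `c₀ / 2 ≤ re ⟨ψ, Y ψ⟩` for EVERY unit vector `ψ ∈ K` — pure linear algebra,
  no representation theory, no genericity in the coupling;
* `hasLRO_of_groundState_moments` : at ONE coupling `U`, the three clauses for the sector ground
  eigenspaces of `hubbardTorus 2 L 1 U` and `Y = Δ_d† Δ_d`, eventually in even `L`, give the
  summit's matrix at `U` (every admissible normalised sector ground-state sequence has
  `d_{x²-y²}` pair-field long-range order along even sides), via
  `hasLRO_of_forall_groundState_bound`;
* `birEveryGroundState_of_moments` : hence `BirEveryGroundState` follows from any mechanism that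
  upgrades the window-average hypothesis to the three clauses at one coupling of the window.

Samuelson-type deviation bounds: Bhatia, *Matrix Analysis* (1997) §I.2 (Frobenius vs operator
norm); Tasaki, *Physics and Mathematics of Quantum Many-Body Systems* (2020) App. A.2.
Everything is folklore; no definition is introduced.
-/

noncomputable section

namespace Summit.HubbardSuperconductivity.HubbardSuperconductivity.Theorems

open Matrix Finset Filter
open Literature.Probability.LatticeModels Literature.MathematicalPhysics.QuantumLattice
open Summit.HubbardSuperconductivity.HubbardSuperconductivity.Theses.BalabanIR
open scoped ComplexOrder

section Moments

variable {n : Type*} [Fintype n] [DecidableEq n]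

/-- **Compression variance head-count.** For Hermitian `Y`, a subspace `K ≠ ⊥` with projection
matrix `P` (`m := re tr P = dim K`) and tracial mean `ȳ := re tr (P Y) / m`, EVERY unit vector
`ψ ∈ K` satisfies `ȳ - √(re tr (P Y P Y) - m ȳ²) ≤ re ⟨ψ, Y ψ⟩`. (With `D = P Y P - ȳ P`,
Hermitian: `re ⟨ψ, Y ψ⟩ - ȳ = re ⟨ψ, D ψ⟩ ≥ -‖D‖_F` and `‖D‖_F² = re tr (P Y P Y) - m ȳ²`.)
Bhatia, *Matrix Analysis* §I.2; Tasaki (2020) App. A.2. [folklore] -/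
theorem compressionVarianceHeadCount (Y : Matrix n n ℂ) (hY : Y.IsHermitian)
    (K : Submodule ℂ (n → ℂ)) (hK : K ≠ ⊥) {ψ : n → ℂ} (hψK : ψ ∈ K) (hψ : star ψ ⬝ᵥ ψ = 1) :
    let P : Matrix n n ℂ := projMatrix (K.map
      ((WithLp.linearEquiv 2 ℂ (n → ℂ)).symm : (n → ℂ) →ₗ[ℂ] EuclideanSpace ℂ n))
    let m : ℝ := P.trace.re
    let ybar : ℝ := (P * Y).trace.re / m
    ybar - Real.sqrt ((P * Y * P * Y).trace.re - m * ybar ^ 2) ≤ (star ψ ⬝ᵥ Y *ᵥ ψ).re := by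
  intro P m ybar
  have hPH : Pᴴ = P := (projMatrix_isHermitian _).eq
  have hPP : P * P = P := projMatrix_mul_self _
  have hPψ : P *ᵥ ψ = ψ := projMatrix_map_mulVec_of_mem K hψK
  -- `m = dim K > 0`, so `re tr (P Y) = m ȳ`
  have hm : m = (Module.finrank ℂ K : ℝ) := by
    show (projMatrix (K.map ((WithLp.linearEquiv 2 ℂ (n → ℂ)).symm :
      (n → ℂ) →ₗ[ℂ] EuclideanSpace ℂ n))).trace.re = _
    rw [trace_projMatrix_map, Complex.natCast_re]
  have hmpos : 0 < m := by
    rw [hm, Nat.cast_pos]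
    exact Module.finrank_pos_iff.mpr (Submodule.nontrivial_iff_ne_bot.mpr hK)
  have hPY : (P * Y).trace.re = m * ybar := by
    show (P * Y).trace.re = m * ((P * Y).trace.re / m)
    field_simp
  -- the traceless Hermitian compression `D`
  set D : Matrix n n ℂ := P * Y * P - (ybar : ℂ) • P with hD
  have hDH : Dᴴ = D := by
    rw [hD, conjTranspose_sub, conjTranspose_smul, conjTranspose_mul, conjTranspose_mul, hPH,
      hY.eq, Complex.star_def, Complex.conj_ofReal, Matrix.mul_assoc]
  -- (1) `re ⟨ψ, Y ψ⟩ - ȳ = re ⟨ψ, D ψ⟩`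
  have h1 : (star ψ ⬝ᵥ D *ᵥ ψ).re = (star ψ ⬝ᵥ Y *ᵥ ψ).re - ybar := by
    have hadj : ∀ w, star ψ ⬝ᵥ (P *ᵥ w) = star (P *ᵥ ψ) ⬝ᵥ w := fun w => by
      rw [star_mulVec, hPH, ← dotProduct_mulVec]
    have hPYψ : star ψ ⬝ᵥ (P *ᵥ (Y *ᵥ ψ)) = star ψ ⬝ᵥ (Y *ᵥ ψ) := by rw [hadj, hPψ]
    rw [hD, sub_mulVec, smul_mulVec, ← mulVec_mulVec, ← mulVec_mulVec, hPψ, dotProduct_sub,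
      dotProduct_smul, hPYψ, hψ, Complex.sub_re, smul_eq_mul, mul_one, Complex.ofReal_re]
  -- (2) `re tr (D D) = re tr (P Y P Y) - m ȳ²`
  have h2 : (Dᴴ * D).trace.re = (P * Y * P * Y).trace.re - m * ybar ^ 2 := by
    rw [hDH, hD]
    have e1 : P * Y * P * (P * Y * P) = P * Y * P * Y * P := by
      calc P * Y * P * (P * Y * P) = P * Y * (P * P) * Y * P := by simp only [Matrix.mul_assoc]
        _ = P * Y * P * Y * P := by rw [hPP]
    have e2 : P * Y * P * P = P * Y * P := by rw [Matrix.mul_assoc, hPP]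
    have e3 : P * (P * Y * P) = P * Y * P := by rw [← Matrix.mul_assoc, ← Matrix.mul_assoc, hPP]
    have t1 : (P * Y * P * Y * P).trace = (P * Y * P * Y).trace := by
      rw [trace_mul_comm, ← Matrix.mul_assoc, ← Matrix.mul_assoc, ← Matrix.mul_assoc, hPP]
    have t2 : (P * Y * P).trace = (P * Y).trace := by
      rw [trace_mul_comm, ← Matrix.mul_assoc, hPP]
    simp only [Matrix.sub_mul, Matrix.mul_sub, Matrix.smul_mul, Matrix.mul_smul, e1, e2, e3, hPP,
      trace_sub, trace_smul, t1, t2, smul_eq_mul, Complex.sub_re, Complex.re_ofReal_mul]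
    have hPre : P.trace.re = m := rfl
    rw [hPY, hPre]
    ring
  have hsq : (star ψ ⬝ᵥ D *ᵥ ψ).re ^ 2 ≤ (P * Y * P * Y).trace.re - m * ybar ^ 2 := by
    have h := sq_re_star_dotProduct_mulVec_le D hψ
    rwa [h2] at h
  have hroot : -Real.sqrt ((P * Y * P * Y).trace.re - m * ybar ^ 2) ≤ (star ψ ⬝ᵥ D *ᵥ ψ).re := by
    rw [neg_le]
    calc -(star ψ ⬝ᵥ D *ᵥ ψ).re ≤ |(star ψ ⬝ᵥ D *ᵥ ψ).re| := neg_le_abs _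
      _ = Real.sqrt ((star ψ ⬝ᵥ D *ᵥ ψ).re ^ 2) := (Real.sqrt_sq_eq_abs _).symm
      _ ≤ Real.sqrt ((P * Y * P * Y).trace.re - m * ybar ^ 2) := Real.sqrt_le_sqrt hsq
  rw [h1] at hroot
  linarith

/-- **Moments ⇒ every** (the Samuelson endgame of `RESHAPE-ideator1.md`, in Frobenius form).
For Hermitian `Y` and a subspace `K ≠ ⊥` with projection matrix `P`: if
`c₀ · re tr P ≤ re tr (P Y)` (the average is at least `c₀ ≥ 0`),
`re tr (P Y P Y) · re tr P ≤ (1 + ε) (re tr (P Y))²` (the compression's second moment is at most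
`(1 + ε)` times the squared mean) and `re tr P ≤ D` with `ε D ≤ 1/4` (bounded degeneracy), then
EVERY unit vector `ψ ∈ K` has `c₀ / 2 ≤ re ⟨ψ, Y ψ⟩`: the tracial variance is `≤ ε m ȳ² ≤ ȳ²/4`,
so by `compressionVarianceHeadCount` nobody falls below `ȳ - ȳ/2 ≥ c₀/2`. No representation
theory and no genericity are involved. Bhatia, *Matrix Analysis* §I.2. [folklore] -/
theorem forall_unit_le_re_of_moments (Y : Matrix n n ℂ) (hY : Y.IsHermitian)
    (K : Submodule ℂ (n → ℂ)) (hK : K ≠ ⊥) {c₀ ε D : ℝ} (hc₀ : 0 ≤ c₀) (hε : 0 ≤ ε)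
    (hεD : ε * D ≤ 1 / 4) :
    let P : Matrix n n ℂ := projMatrix (K.map
      ((WithLp.linearEquiv 2 ℂ (n → ℂ)).symm : (n → ℂ) →ₗ[ℂ] EuclideanSpace ℂ n))
    c₀ * P.trace.re ≤ (P * Y).trace.re →
    (P * Y * P * Y).trace.re * P.trace.re ≤ (1 + ε) * (P * Y).trace.re ^ 2 →
    P.trace.re ≤ D →
    ∀ ψ ∈ K, star ψ ⬝ᵥ ψ = 1 → c₀ / 2 ≤ (star ψ ⬝ᵥ Y *ᵥ ψ).re := by
  intro P havg hmom hdeg ψ hψK hψ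
  have hm : P.trace.re = (Module.finrank ℂ K : ℝ) := by
    show (projMatrix (K.map ((WithLp.linearEquiv 2 ℂ (n → ℂ)).symm :
      (n → ℂ) →ₗ[ℂ] EuclideanSpace ℂ n))).trace.re = _
    rw [trace_projMatrix_map, Complex.natCast_re]
  have hmpos : 0 < P.trace.re := by
    rw [hm, Nat.cast_pos]
    exact Module.finrank_pos_iff.mpr (Submodule.nontrivial_iff_ne_bot.mpr hK)
  have hhead : (P * Y).trace.re / P.trace.re -
      Real.sqrt ((P * Y * P * Y).trace.re - P.trace.re * ((P * Y).trace.re / P.trace.re) ^ 2) ≤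
        (star ψ ⬝ᵥ Y *ᵥ ψ).re :=
    compressionVarianceHeadCount Y hY K hK hψK hψ
  -- write `re tr (P Y) = m ȳ`
  obtain ⟨ybar, hybar⟩ : ∃ ybar : ℝ, (P * Y).trace.re = P.trace.re * ybar :=
    ⟨(P * Y).trace.re / P.trace.re, by field_simp⟩
  have hdiv : (P * Y).trace.re / P.trace.re = ybar := by
    rw [hybar, mul_div_cancel_left₀ _ hmpos.ne']
  rw [hdiv] at hhead
  rw [hybar] at havg hmom
  generalize hmm : P.trace.re = m at *
  generalize hT : (P * Y * P * Y).trace.re = T at *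
  -- `c₀ ≤ ȳ`
  have hyc : c₀ ≤ ybar := le_of_mul_le_mul_left (by linarith [havg]) hmpos
  have hy0 : 0 ≤ ybar := hc₀.trans hyc
  -- the tracial variance is `≤ (ȳ / 2)²`
  have hTle : T ≤ (1 + ε) * m * ybar ^ 2 := by
    refine le_of_mul_le_mul_right ?_ hmpos
    calc T * m ≤ (1 + ε) * (m * ybar) ^ 2 := hmom
      _ = (1 + ε) * m * ybar ^ 2 * m := by ring
  have h1 : ε * m * ybar ^ 2 ≤ ε * D * ybar ^ 2 :=
    mul_le_mul_of_nonneg_right (mul_le_mul_of_nonneg_left hdeg hε) (sq_nonneg _)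
  have h2 : ε * D * ybar ^ 2 ≤ 1 / 4 * ybar ^ 2 := mul_le_mul_of_nonneg_right hεD (sq_nonneg _)
  have hvar : T - m * ybar ^ 2 ≤ (ybar / 2) ^ 2 := by nlinarith [hTle, h1, h2]
  have hsqrt : Real.sqrt (T - m * ybar ^ 2) ≤ ybar / 2 :=
    (Real.sqrt_le_sqrt hvar).trans_eq (Real.sqrt_sq (by linarith))
  linarith

end Moments

/-! ### The Hubbard closure: the three trace clauses at one coupling ⇒ the summit's matrix -/

section Hubbard

/-- **Average + second moment + bounded degeneracy at ONE coupling ⇒ the summit's matrix there**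
(`RESHAPE-ideator1.md`, item `BirEveryOfMoments`, proved). Fix `U`, `δ > -1`... more precisely
`δ ∈ (0, 1/2)` is only used through `δ ≥ -1` (non-vacuity of the sector), `c > 0`, `ε ≥ 0`, `D`
with `ε D ≤ 1/4`. If eventually in even `L` the projection `P` onto the sector ground eigenspace
`E₀ = szSector N_L 0 ⊓ ker (H - e₀)` of `H = hubbardTorus 2 L 1 U` and `O = Δ_d† Δ_d` satisfy
`c L⁴ · re tr P ≤ re tr (P O)`, `re tr (P O P O) · re tr P ≤ (1 + ε) (re tr (P O))²` and
`re tr P ≤ D`, then every normalised sector ground state has `(c/2) L⁴ ≤ re ⟨ψ, O ψ⟩`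
(`forall_unit_le_re_of_moments`), hence every admissible sequence has `d_{x²-y²}` pair-field
long-range order along even sides (`hasLRO_of_forall_groundState_bound`). Scalapino, Phys. Rep.
250 (1995) §2; Bhatia §I.2. [folklore] -/
theorem hasLRO_of_groundState_moments (U δ c ε D : ℝ) (hδ : -1 ≤ δ) (hc : 0 < c) (hε : 0 ≤ ε)
    (hεD : ε * D ≤ 1 / 4) (L₀ : ℕ)
    (h : ∀ (L : ℕ) [NeZero L], L₀ ≤ L → Even L →
      let N : ℕ := 2 * ⌊(1 - δ) * (L : ℝ) ^ 2 / 2⌋₊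
      let H := hubbardTorus 2 L 1 U
      let S := szSector (Λ := FermionTorus 2 L) N 0
      let E₀ := S ⊓ Module.End.eigenspace (Matrix.toLin' H) ((H.minEnergyOn S : ℝ) : ℂ)
      let P := projMatrix (E₀.map (Fock.toEuclidean (ι := Orb (FermionTorus 2 L)) :
        Fock (Orb (FermionTorus 2 L)) →ₗ[ℂ] EuclideanSpace ℂ (Finset (Orb (FermionTorus 2 L)))))
      let O := (pairField dWaveFormFactor L)ᴴ * pairField dWaveFormFactor L
      c * (L : ℝ) ^ 4 * P.trace.re ≤ (P * O).trace.re ∧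
        (P * O * P * O).trace.re * P.trace.re ≤ (1 + ε) * (P * O).trace.re ^ 2 ∧
        P.trace.re ≤ D)
    (N : ℕ → ℕ) (ψ : ∀ L, Fock (Orb (FermionTorus 2 L)))
    (hadm : ∀ L, Even L → N L = 2 * ⌊(1 - δ) * (L : ℝ) ^ 2 / 2⌋₊ ∧ star (ψ L) ⬝ᵥ ψ L = 1 ∧
      IsGroundStateInSector (hubbardTorus 2 L 1 U) (N L) 0 (ψ L)) :
    HasLongRangeOrder (fun k => halfOpenBox 2 (2 * k))
      (fun k => torusPullback (pairFieldCorr dWaveFormFactor ψ) (2 * k)) := by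
  refine hasLRO_of_forall_groundState_bound U δ (c / 2) (half_pos hc) L₀
    (fun L _ hL hLe φ hgs hunit => ?_) N ψ hadm
  obtain ⟨havg, hmom, hdeg⟩ := h L hL hLe
  -- name the objects of side `L`
  set A : Matrix (Finset (Orb (FermionTorus 2 L))) (Finset (Orb (FermionTorus 2 L))) ℂ :=
    (pairField dWaveFormFactor L)ᴴ * pairField dWaveFormFactor L with hA
  set H := hubbardTorus 2 L 1 U with hH
  set S := szSector (Λ := FermionTorus 2 L) (2 * ⌊(1 - δ) * (L : ℝ) ^ 2 / 2⌋₊) 0 with hS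
  set E₀ := S ⊓ Module.End.eigenspace (Matrix.toLin' H) ((H.minEnergyOn S : ℝ) : ℂ) with hE₀
  rw [map_toEuclidean_eq] at havg hmom hdeg
  have hAH : A.IsHermitian := Matrix.isHermitian_conjTranspose_mul_self _
  have hne : E₀ ≠ ⊥ := hubbardTorus_groundEigenspace_ne_bot 2 L 1 U
    (m := ⌊(1 - δ) * (L : ℝ) ^ 2 / 2⌋₊)
    (by rw [NoGo.card_fermionTorus_two]; exact NoGo.floor_pairNumber_le δ hδ L)
  have hφE : φ ∈ E₀ := by
    refine Submodule.mem_inf.mpr ⟨hgs.1, ?_⟩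
    rw [Module.End.mem_eigenspace_iff, Matrix.toLin'_apply]
    exact hgs.2.2
  have hc0 : 0 ≤ c * (L : ℝ) ^ 4 := by positivity
  have key := forall_unit_le_re_of_moments A hAH E₀ hne hc0 hε hεD havg hmom hdeg φ hφE hunit
  linarith [key]

/-- **`BirEveryGroundState` ⇐ a moment upgrade of the window average.** The crux follows from any
mechanism turning its window-average hypothesis into: ONE coupling `U` of the window, `ε ≥ 0`, `D`
with `ε D ≤ 1/4` and a threshold beyond which, at even sides, the sector ground projection `P` and
`O = Δ_d† Δ_d` obey the average clause `c' L⁴ re tr P ≤ re tr (P O)` (`c' > 0`), the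
second-moment clause `re tr (P O P O) · re tr P ≤ (1 + ε) (re tr (P O))²` and the bounded-degeneracy
clause `re tr P ≤ D` (`hasLRO_of_groundState_moments`). This is the genericity-free alternative
to the Kato–Schur line (`birEveryGroundState_of_scalarOnGround`). [folklore] -/
theorem birEveryGroundState_of_moments
    (h : ∀ (δ U₁ U₂ c : ℝ), δ ∈ Set.Ioo (0:ℝ) (1/2) → 0 < U₁ → U₁ < U₂ → 0 < c →
      (∀ U ∈ Set.Ioo U₁ U₂, ∃ L₀ : ℕ, ∀ (L : ℕ) [NeZero L], L₀ ≤ L → Even L →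
        let N : ℕ := 2 * ⌊(1 - δ) * (L : ℝ) ^ 2 / 2⌋₊
        let H := hubbardTorus 2 L 1 U
        let S := szSector (Λ := FermionTorus 2 L) N 0
        let E₀ := S ⊓ Module.End.eigenspace (Matrix.toLin' H) ((H.minEnergyOn S : ℝ) : ℂ)
        let P := projMatrix (E₀.map (Fock.toEuclidean (ι := Orb (FermionTorus 2 L)) :
          Fock (Orb (FermionTorus 2 L)) →ₗ[ℂ] EuclideanSpace ℂ (Finset (Orb (FermionTorus 2 L)))))
        c * (L : ℝ) ^ 4 * P.trace.re ≤
          (P * ((pairField dWaveFormFactor L)ᴴ * pairField dWaveFormFactor L)).trace.re) →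
      ∃ U ∈ Set.Ioo U₁ U₂, ∃ c' ε D : ℝ, 0 < c' ∧ 0 ≤ ε ∧ ε * D ≤ 1 / 4 ∧
        ∃ L₀ : ℕ, ∀ (L : ℕ) [NeZero L], L₀ ≤ L → Even L →
        let N : ℕ := 2 * ⌊(1 - δ) * (L : ℝ) ^ 2 / 2⌋₊
        let H := hubbardTorus 2 L 1 U
        let S := szSector (Λ := FermionTorus 2 L) N 0
        let E₀ := S ⊓ Module.End.eigenspace (Matrix.toLin' H) ((H.minEnergyOn S : ℝ) : ℂ)
        let P := projMatrix (E₀.map (Fock.toEuclidean (ι := Orb (FermionTorus 2 L)) :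
          Fock (Orb (FermionTorus 2 L)) →ₗ[ℂ] EuclideanSpace ℂ (Finset (Orb (FermionTorus 2 L)))))
        let O := (pairField dWaveFormFactor L)ᴴ * pairField dWaveFormFactor L
        c' * (L : ℝ) ^ 4 * P.trace.re ≤ (P * O).trace.re ∧
          (P * O * P * O).trace.re * P.trace.re ≤ (1 + ε) * (P * O).trace.re ^ 2 ∧
          P.trace.re ≤ D) :
    BirEveryGroundState := by
  intro δ U₁ U₂ c hδ hU₁ hU₁₂ hc hyp
  obtain ⟨U, hU, c', ε, D, hc', hε, hεD, L₀, hL₀⟩ := h δ U₁ U₂ c hδ hU₁ hU₁₂ hc hyp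
  have hδ' : (-1 : ℝ) ≤ δ := by linarith [hδ.1]
  exact ⟨U, hU, fun N ψ hadm =>
    hasLRO_of_groundState_moments U δ c' ε D hδ' hc' hε hεD L₀
      (fun L _ hL hLe => hL₀ L hL hLe) N ψ hadm⟩

end Hubbard

end Summit.HubbardSuperconductivity.HubbardSuperconductivity.Theorems
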